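import Summits.ValiantsHypothesis.ValiantsHypothesis.Theses.SOSTau
import Literature.Computability.AlgebraicComplexity.RealTauKnownCases

/-!
# Crux `SOSTau.SOSTau` (stmt-ValiantsHypothesis-18748), line `Sketch`: stub B `stub_cruxOfPos`

Pure bookkeeping: the POSITIVE-zero form of Dutta's SOS-τ conjecture (for some absolute `c`, every real
weighted sum of squares `F = Σ_{i<s} aᵢ gᵢ²` has at most `c · Σᵢ |supp gᵢ|` distinct POSITIVE zeros) implies
the conjecture itself (crux `SOSTau`), with constant `2c + 1`.

Proof: the distinct real zeros of `F` are the negative ones, possibly `0`, and the positive ones, so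
`#zeros ≤ #neg + 1 + #pos`.  The negative zeros of `F` inject (`x ↦ −x`, Mathlib `Polynomial.roots_comp_neg_X`)
into the positive zeros of `F(−X) = Σ aᵢ (gᵢ(−X))²`, a representation with the SAME support cards
(tree `Literature.Computability.AlgebraicComplexity.support_comp_neg_X`), so both `#neg` and `#pos` are
`≤ c·S` (`S = Σ|supp gᵢ|`), and `2c·S + 1 ≤ (2c+1)·S` once `S ≥ 1`; if `S = 0` every `gᵢ` vanishes, `F = 0`
and `F` has no recorded roots.
-/

set_option linter.dupNamespace false

open Polynomial

namespace Summit.ValiantsHypothesis.ValiantsHypothesis.Theorems.SOSTauSOSTau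

/-- `F(−X)` of a weighted sum of squares is the weighted sum of the squares of the `gᵢ(−X)`, same weights. -/
theorem sum_C_mul_sq_comp_neg_X (s : ℕ) (a : Fin s → ℝ) (g : Fin s → ℝ[X]) :
    (∑ i, C (a i) * g i ^ 2).comp (-X) = ∑ i, C (a i) * ((g i).comp (-X)) ^ 2 := by
  rw [Polynomial.sum_comp]
  refine Finset.sum_congr rfl fun i _ => ?_
  rw [Polynomial.mul_comp, Polynomial.C_comp, Polynomial.pow_comp]

/-- The distinct negative zeros of `F` inject, by `x ↦ −x`, into the distinct positive zeros of `F(−X)`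
(adapted from the tree proof of `card_roots_toFinset_filter_neg_lt_card_support`). -/
theorem card_filter_neg_le_card_filter_pos_comp_neg_X (F : ℝ[X]) :
    (F.roots.toFinset.filter (· < 0)).card ≤
      ((F.comp (-X)).roots.toFinset.filter (fun x => 0 < x)).card := by
  rw [roots_comp_neg_X]
  refine Finset.card_le_card_of_injOn (fun x => -x) ?_ ?_
  · intro x hx
    simp only [Finset.coe_filter, Set.mem_setOf_eq, Multiset.mem_toFinset, Multiset.mem_map] at hx ⊢
    exact ⟨⟨x, hx.1, rfl⟩, neg_pos.mpr hx.2⟩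
  · exact fun x _ y _ h => neg_injective h

/-- Trichotomy: the distinct zeros of `F` number at most `#negative + 1 + #positive`. -/
theorem card_roots_toFinset_le_neg_add_one_add_pos (F : ℝ[X]) :
    F.roots.toFinset.card ≤
      (F.roots.toFinset.filter (· < 0)).card + 1 + (F.roots.toFinset.filter (fun x => 0 < x)).card := by
  have hsub : F.roots.toFinset ⊆
      (F.roots.toFinset.filter (· < 0) ∪ {0}) ∪ F.roots.toFinset.filter (fun x => 0 < x) := by
    intro x hx
    rcases lt_trichotomy x 0 with h | h | h
    · exact Finset.mem_union_left _ (Finset.mem_union_left _ (Finset.mem_filter.mpr ⟨hx, h⟩))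
    · exact Finset.mem_union_left _ (Finset.mem_union_right _ (Finset.mem_singleton.mpr h))
    · exact Finset.mem_union_right _ (Finset.mem_filter.mpr ⟨hx, h⟩)
  have h1 := Finset.card_le_card hsub
  have h2 := Finset.card_union_le (F.roots.toFinset.filter (· < 0) ∪ {0})
    (F.roots.toFinset.filter (fun x => 0 < x))
  have h3 := Finset.card_union_le (F.roots.toFinset.filter (· < 0)) ({0} : Finset ℝ)
  rw [Finset.card_singleton] at h3
  omega

/-- With the positive-zero bound `#pos ≤ c·S` for EVERY representation, the negative zeros obey the same bound:
apply it to the representation `F(−X) = Σ aᵢ (gᵢ(−X))²`, whose support cards are those of the `gᵢ`. -/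
theorem card_filter_neg_le_of_pos {c : ℕ}
    (hc : ∀ (s : ℕ) (a : Fin s → ℝ) (g : Fin s → ℝ[X]),
      ((∑ i, Polynomial.C (a i) * g i ^ 2).roots.toFinset.filter (fun x => 0 < x)).card ≤
        c * ∑ i, (g i).support.card)
    (s : ℕ) (a : Fin s → ℝ) (g : Fin s → ℝ[X]) :
    ((∑ i, Polynomial.C (a i) * g i ^ 2).roots.toFinset.filter (· < 0)).card ≤
      c * ∑ i, (g i).support.card := by
  have h := hc s a (fun i => (g i).comp (-X))
  simp only [Literature.Computability.AlgebraicComplexity.support_comp_neg_X] at h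
  rw [← sum_C_mul_sq_comp_neg_X s a g] at h
  exact (card_filter_neg_le_card_filter_pos_comp_neg_X _).trans h

/-- If every support card vanishes, the weighted sum of squares is `0`. -/
theorem sum_C_mul_sq_eq_zero_of_sum_card_support_eq_zero (s : ℕ) (a : Fin s → ℝ) (g : Fin s → ℝ[X])
    (hS : ∑ i, (g i).support.card = 0) : (∑ i, Polynomial.C (a i) * g i ^ 2) = 0 := by
  have hg : ∀ i, g i = 0 := fun i => by
    have := (Finset.sum_eq_zero_iff.mp hS) i (Finset.mem_univ i)
    rwa [Finset.card_eq_zero, Polynomial.support_eq_empty] at this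
  exact Finset.sum_eq_zero fun i _ => by simp [hg i]

/-- **Stub B of line `Sketch`** (`Stmt.posCount → Crux`): the positive-zero form of SOS-τ implies Dutta's SOS-τ
conjecture `SOSTau` (constant `c ↦ 2c + 1`: negative zeros via `x ↦ −x`, which keeps supports, plus the zero `0`). -/
theorem stub_cruxOfPos :
    (∃ c : ℕ, ∀ (s : ℕ) (a : Fin s → ℝ) (g : Fin s → ℝ[X]),
      ((∑ i, Polynomial.C (a i) * g i ^ 2).roots.toFinset.filter (fun x => 0 < x)).card ≤
        c * ∑ i, (g i).support.card) →
    Summit.ValiantsHypothesis.ValiantsHypothesis.Theses.SOSTau.SOSTau := by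
  rintro ⟨c, hc⟩
  refine ⟨2 * c + 1, fun s a g => ?_⟩
  have hpos := hc s a g
  have hneg := card_filter_neg_le_of_pos hc s a g
  have hsplit := card_roots_toFinset_le_neg_add_one_add_pos (∑ i, Polynomial.C (a i) * g i ^ 2)
  rcases Nat.eq_zero_or_pos (∑ i, (g i).support.card) with hS | hS
  · rw [sum_C_mul_sq_eq_zero_of_sum_card_support_eq_zero s a g hS, Polynomial.roots_zero,
      Multiset.toFinset_zero, Finset.card_empty]
    exact Nat.zero_le _
  · have key : (2 * c + 1) * ∑ i, (g i).support.card =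
        2 * (c * ∑ i, (g i).support.card) + ∑ i, (g i).support.card := by ring
    rw [key]
    omega

end Summit.ValiantsHypothesis.ValiantsHypothesis.Theorems.SOSTauSOSTau
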